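import Summits.AtomisticToContinuum.FouriersLaw.Theses.PhononMeanFreePath
import Summits.AtomisticToContinuum.FouriersLaw.Theorems.BoundaryKubo.Negative.LoadBearing
import Summits.AtomisticToContinuum.FouriersLaw.Theorems.BondHeatUncertaintySubdiffusiveBondHeatKernelGibbsE
import Summits.AtomisticToContinuum.FouriersLaw.Theorems.PhononMeanFreePathBoundaryKuboGibbsTTCFAux2
import Mathlib.MeasureTheory.Integral.IntegralEqImproper
import Mathlib.MeasureTheory.Integral.ExpDecay

/-!
# Limit exchange for the end kinetic temperature, helper 1: Harris remainders under the Gibbs measure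
(helpers for stub `stub_limitExchange` of line `gibbs-ttcf`, crux stmt-AtomisticToContinuum-11812
`PhononMeanFreePath.BoundaryKubo`)

Pure measure theory around ONE hypothesis, the Harris bound at a pair of bath temperatures `(a, b)`:
a measure `ν` and constants `θ, C, c` with `|K_t f(z) - ν(f)| ≤ C e^{θH(z)} e^{-ct}` for all continuous
`|f| ≤ e^{θH}`, `K_t = transitionKernel M a b t` the constructed kernels of the pinned chain.

* `harris_sq_momentum` — the bound for `f = p_i²`: `|K_t p_i²(z) - ν(p_i²)| ≤ (2C/θ) e^{θH(z)} e^{-ct}`;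
  `abs_steady_sq_momentum_le` — `|ν(p_i²)| ≤ (2C/θ) e^{θH(0)}` (`K_0 = id` at the origin).
* `corr_decay` (registered closed form `limitExchange_corrDecay`) — for the Gibbs measure `μ₀` at `T` with
  `θ + ϑ < 1/T` and continuous `|g| ≤ C_g e^{ϑH}`: `g · K_t p_i²` is `μ₀`-integrable and
  `|μ₀(g · K_t p_i²) - μ₀(g) ν(p_i²)| ≤ (2C/θ) C_g μ₀(e^{(θ+ϑ)H}) e^{-ct}` — constants independent of `(a, b, ν)`.
* `measurable_corr_time` — `u ↦ ∫ g · K_{u⁺} h dμ` is measurable (joint measurability of the kernels).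
* `tendsto_temperatures` — a function continuous on `(0,∞)²` is continuous along `δ ↦ (T + δ/2, T - δ/2)` at `0`.
* `tendsto_of_abs_sub_le_exp`, `integrableOn_Ioi_of_abs_le_exp`, `eq_integral_Ioi_of_interval_identity` —
  real-variable lemmas: exponential remainders, and `S → ∞` in an identity `L(S) = κ ∫₀^S Φ`.
* `tendsto_corr_delta` — `δ → 0` inside the Gibbs integral `∫ g · K^δ_s p_N² dμ₀` under a Harris bound uniform
  in `|δ| ≤ δ₀` and pointwise continuity of `δ ↦ K^δ_s p_N²(z)` (dominated convergence).
-/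

noncomputable section

open scoped NNReal ENNReal Topology
open MeasureTheory Filter Set

namespace Summit.AtomisticToContinuum.FouriersLaw.Theorems.BoundaryKubo.GibbsTtcf

open Literature.MathematicalPhysics.KineticTheory.HeatConduction
open Literature.MathematicalPhysics.KineticTheory Literature.Probability.Process OscillatorChain
open ProbabilityTheory
open Summit.AtomisticToContinuum.FouriersLaw.Theorems.SubdiffusiveBondHeat

/-! ### Real-variable lemmas -/

/-- If `|L(S) - ℓ| ≤ M e^{-cS}` for `S ≥ 0` and `c > 0` then `L(S) → ℓ` as `S → ∞`. [folklore] -/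
theorem tendsto_of_abs_sub_le_exp {L : ℝ → ℝ} {ℓ M c : ℝ} (hc : 0 < c)
    (h : ∀ S, 0 ≤ S → |L S - ℓ| ≤ M * Real.exp (-c * S)) : Tendsto L atTop (𝓝 ℓ) := by
  have hexp : Tendsto (fun S : ℝ => M * Real.exp (-c * S)) atTop (𝓝 (M * 0)) :=
    (Real.tendsto_exp_atBot.comp (tendsto_id.const_mul_atTop_of_neg (neg_neg_iff_pos.2 hc))).const_mul M
  rw [mul_zero] at hexp
  have h0 : Tendsto (fun S => L S - ℓ) atTop (𝓝 0) := by
    refine squeeze_zero_norm' ?_ hexp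
    filter_upwards [eventually_ge_atTop (0 : ℝ)] with S hS
    rw [Real.norm_eq_abs]
    exact h S hS
  have := h0.add_const ℓ
  simpa using this

/-- A measurable `Φ` with `|Φ(s)| ≤ M e^{-cs}` on `(0, ∞)`, `c > 0`, is integrable on `(0, ∞)`. [folklore] -/
theorem integrableOn_Ioi_of_abs_le_exp {Φ : ℝ → ℝ} {M c : ℝ} (hc : 0 < c) (hΦm : Measurable Φ)
    (hΦb : ∀ s, 0 < s → |Φ s| ≤ M * Real.exp (-c * s)) : IntegrableOn Φ (Ioi 0) := by
  refine Integrable.mono' ((exp_neg_integrableOn_Ioi 0 hc).const_mul M) hΦm.aestronglyMeasurable ?_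
  refine (ae_restrict_iff' measurableSet_Ioi).2 (Eventually.of_forall fun s hs => ?_)
  rw [Real.norm_eq_abs]
  exact hΦb s hs

/-- **`S → ∞` in a finite-time identity.** If `L(S) → ℓ`, `Φ` is integrable on `(0, ∞)` and
`L(S) = κ ∫₀^S Φ` for all `S ≥ 0`, then `ℓ = κ ∫_{(0,∞)} Φ`. [folklore] -/
theorem eq_integral_Ioi_of_interval_identity {L Φ : ℝ → ℝ} {ℓ κ : ℝ} (hL : Tendsto L atTop (𝓝 ℓ))
    (hΦ : IntegrableOn Φ (Ioi 0)) (hid : ∀ S, 0 ≤ S → L S = κ * ∫ s in (0 : ℝ)..S, Φ s) :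
    ℓ = κ * ∫ s in Ioi (0 : ℝ), Φ s := by
  have hR : Tendsto (fun S : ℝ => κ * ∫ s in (0 : ℝ)..S, Φ s) atTop (𝓝 (κ * ∫ s in Ioi (0 : ℝ), Φ s)) :=
    (intervalIntegral_tendsto_integral_Ioi 0 hΦ tendsto_id).const_mul κ
  have hEq : L =ᶠ[atTop] fun S : ℝ => κ * ∫ s in (0 : ℝ)..S, Φ s := by
    filter_upwards [eventually_ge_atTop (0 : ℝ)] with S hS
    exact hid S hS
  exact tendsto_nhds_unique (hL.congr' hEq) hR

/-- A function continuous on the open quadrant `(0,∞)²` is continuous at `(T, T)` along the symmetric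
temperature protocol `δ ↦ (T + δ/2, T - δ/2)`, `T > 0`. [folklore] -/
theorem tendsto_temperatures {F : ℝ × ℝ → ℝ} {T : ℝ} (hT : 0 < T)
    (hF : ContinuousOn F (Set.Ioi (0 : ℝ) ×ˢ Set.Ioi (0 : ℝ))) :
    Tendsto (fun δ : ℝ => F (T + δ / 2, T - δ / 2)) (𝓝 0) (𝓝 (F (T, T))) := by
  have hc : ContinuousAt F (T, T) :=
    hF.continuousAt ((isOpen_Ioi.prod isOpen_Ioi).mem_nhds ⟨hT, hT⟩)
  have hp : Tendsto (fun δ : ℝ => (T + δ / 2, T - δ / 2)) (𝓝 0) (𝓝 (T, T)) :=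
    ((continuous_const.add (continuous_id.div_const 2)).prodMk
      (continuous_const.sub (continuous_id.div_const 2))).tendsto' 0 (T, T) (by simp)
  exact hc.tendsto.comp hp

/-! ### Measurability in time of kernel correlations -/

section Measurability

variable {ω₂ lam β γ : ℝ} (hω : 0 < ω₂) (hl : 0 ≤ lam) (hβ : 0 ≤ β) (hγ : 0 ≤ γ)
include hω hl hβ hγ

/-- For continuous `g, h`, any bath temperatures `a, b` and any s-finite measure `μ` on phase space,
`u ↦ ∫ g(z) · (∫ h dK_{u⁺}(z, ·)) dμ(z)` is measurable (`K = transitionKernel M a b`, jointly measurable in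
`(t, z)` by `pinnedChain_measurable_transitionKernel`). [folklore] -/
theorem measurable_corr_time (M : ℕ) (a b : ℝ) (μ : Measure (PhaseSpace M)) [SFinite μ]
    {g h : PhaseSpace M → ℝ} (hg : Continuous g) (hh : Continuous h) :
    Measurable fun u : ℝ => ∫ z, g z *
      (∫ y, h y ∂((pinnedChain ω₂ lam β γ).transitionKernel M a b u.toNNReal z)) ∂μ := by
  set P := pinnedChain ω₂ lam β γ with hP
  let κ₂ : Kernel (ℝ≥0 × PhaseSpace M) (PhaseSpace M) :=
    { toFun := fun p => P.transitionKernel M a b p.1 p.2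
      measurable' := pinnedChain_measurable_transitionKernel hω hl hβ hγ M a b }
  have hG : StronglyMeasurable fun p : ℝ≥0 × PhaseSpace M => ∫ y, h y ∂(κ₂ p) :=
    hh.stronglyMeasurable.integral_kernel (κ := κ₂)
  have hF : StronglyMeasurable fun q : ℝ × PhaseSpace M =>
      g q.2 * ∫ y, h y ∂(P.transitionKernel M a b q.1.toNNReal q.2) := by
    have h1 : StronglyMeasurable fun q : ℝ × PhaseSpace M => g q.2 :=
      (hg.comp continuous_snd).stronglyMeasurable
    have h2 : StronglyMeasurable fun q : ℝ × PhaseSpace M => ∫ y, h y ∂(κ₂ (q.1.toNNReal, q.2)) :=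
      hG.comp_measurable ((measurable_real_toNNReal.comp measurable_fst).prodMk measurable_snd)
    exact h1.mul h2
  exact (hF.integral_prod_right' (ν := μ)).measurable

end Measurability

/-! ### Consequences of a Harris bound at one pair of bath temperatures -/

section Harris

variable {ω₂ lam β γ : ℝ} (hω : 0 < ω₂) (hl : 0 ≤ lam) (hβ : 0 ≤ β) (hγ : 0 ≤ γ) {M : ℕ}
  {a b : ℝ} {ν : Measure (PhaseSpace M)} {θ C c : ℝ} (hθ : 0 < θ)
  (hH : ∀ (z : PhaseSpace M) (t : ℝ≥0) (f : PhaseSpace M → ℝ), Continuous f →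
    (∀ y, |f y| ≤ Real.exp (θ * (pinnedChain ω₂ lam β γ).hamiltonian M y)) →
    |(∫ y, f y ∂((pinnedChain ω₂ lam β γ).transitionKernel M a b t z)) - ∫ y, f y ∂ν| ≤
      C * Real.exp (θ * (pinnedChain ω₂ lam β γ).hamiltonian M z) * Real.exp (-c * t))
include hω hl hβ hγ hθ hH

/-- The Harris bound for the squared momentum `p_i²` (apply it to `f = (θ/2) p_i²`, `|f| ≤ e^{θH}` because
`p_i² ≤ 2H ≤ (2/θ) e^{θH}`): `|K_t p_i²(z) - ν(p_i²)| ≤ (2C/θ) e^{θH(z)} e^{-ct}`. [folklore] -/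
theorem harris_sq_momentum (i : Fin M) (z : PhaseSpace M) (t : ℝ≥0) :
    |(∫ y, y.2 i ^ 2 ∂((pinnedChain ω₂ lam β γ).transitionKernel M a b t z)) - ∫ y, y.2 i ^ 2 ∂ν| ≤
      2 / θ * C * Real.exp (θ * (pinnedChain ω₂ lam β γ).hamiltonian M z) * Real.exp (-c * t) := by
  have hP := pinnedChain_isConfining hω hl hβ hγ
  have hθ2 : (0 : ℝ) < θ / 2 := by positivity
  have hf : Continuous fun y : PhaseSpace M => θ / 2 * y.2 i ^ 2 := by fun_prop
  have hfb : ∀ y : PhaseSpace M,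
      |θ / 2 * y.2 i ^ 2| ≤ Real.exp (θ * (pinnedChain ω₂ lam β γ).hamiltonian M y) := by
    intro y
    have h := abs_sq_momentum_le_exp hP hθ M y i
    rw [abs_mul, abs_of_pos hθ2]
    calc θ / 2 * |y.2 i ^ 2|
        ≤ θ / 2 * (2 / θ * Real.exp (θ * (pinnedChain ω₂ lam β γ).hamiltonian M y)) :=
          mul_le_mul_of_nonneg_left h hθ2.le
      _ = Real.exp (θ * (pinnedChain ω₂ lam β γ).hamiltonian M y) := by
          field_simp
  have h := hH z t _ hf hfb
  rw [integral_const_mul, integral_const_mul, ← mul_sub, abs_mul, abs_of_pos hθ2] at h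
  calc |(∫ y, y.2 i ^ 2 ∂((pinnedChain ω₂ lam β γ).transitionKernel M a b t z)) - ∫ y, y.2 i ^ 2 ∂ν|
      = 2 / θ * (θ / 2 * |(∫ y, y.2 i ^ 2 ∂((pinnedChain ω₂ lam β γ).transitionKernel M a b t z)) -
          ∫ y, y.2 i ^ 2 ∂ν|) := by
        field_simp
    _ ≤ 2 / θ * (C * Real.exp (θ * (pinnedChain ω₂ lam β γ).hamiltonian M z) * Real.exp (-c * t)) :=
        mul_le_mul_of_nonneg_left h (by positivity)
    _ = _ := by ring

/-- The steady second moment is controlled by the Harris constant: `|ν(p_i²)| ≤ (2C/θ) e^{θH(0)}`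
(the bound `harris_sq_momentum` at `t = 0`, `z = 0`, where `K_0 = id` and `p_i²(0) = 0`). [folklore] -/
theorem abs_steady_sq_momentum_le (i : Fin M) :
    |∫ y, y.2 i ^ 2 ∂ν| ≤ 2 / θ * C * Real.exp (θ * (pinnedChain ω₂ lam β γ).hamiltonian M 0) := by
  have h := harris_sq_momentum hω hl hβ hγ hθ hH i 0 0
  rw [pinnedChain_transitionKernel_zero hω hl hβ hγ M a b, Kernel.id_apply, integral_dirac] at h
  simpa [abs_sub_comm] using h

/-- **Harris remainders under the Gibbs measure** (the workhorse of the limit exchange). For the Gibbs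
measure `μ₀` at `T > 0`, `ϑ` with `θ + ϑ < 1/T`, a continuous weight `|g| ≤ C_g e^{ϑH}` and `t ≥ 0`:
`z ↦ g(z) K_t p_i²(z)` is `μ₀`-integrable and
`|∫ g · K_t p_i² dμ₀ - (∫ g dμ₀) · ν(p_i²)| ≤ (2C/θ) C_g (∫ e^{(θ+ϑ)H} dμ₀) e^{-ct}`
(write `g K_t p_i² = g (K_t p_i² - ν(p_i²)) + ν(p_i²) g` and use `harris_sq_momentum`). [folklore] -/
theorem corr_decay {T : ℝ} (hT : 0 < T) {ϑ Cg : ℝ} (hθϑ : θ + ϑ < 1 / T)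
    {g : PhaseSpace M → ℝ} (hg : Continuous g)
    (hgb : ∀ z, |g z| ≤ Cg * Real.exp (ϑ * (pinnedChain ω₂ lam β γ).hamiltonian M z)) (i : Fin M)
    (t : ℝ≥0) :
    Integrable (fun z => g z * ∫ y, y.2 i ^ 2 ∂((pinnedChain ω₂ lam β γ).transitionKernel M a b t z))
        ((pinnedChain ω₂ lam β γ).gibbsMeasure M T) ∧
    |(∫ z, g z * ∫ y, y.2 i ^ 2 ∂((pinnedChain ω₂ lam β γ).transitionKernel M a b t z)
        ∂((pinnedChain ω₂ lam β γ).gibbsMeasure M T)) -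
      (∫ z, g z ∂((pinnedChain ω₂ lam β γ).gibbsMeasure M T)) * ∫ y, y.2 i ^ 2 ∂ν| ≤
      2 / θ * C * Cg * (∫ z, Real.exp ((θ + ϑ) * (pinnedChain ω₂ lam β γ).hamiltonian M z)
        ∂((pinnedChain ω₂ lam β γ).gibbsMeasure M T)) * Real.exp (-c * t) := by
  set P := pinnedChain ω₂ lam β γ with hPdef
  set μ₀ := P.gibbsMeasure M T with hμ₀
  set κ := P.transitionKernel M a b t with hκ
  set kA : PhaseSpace M → ℝ := fun z => ∫ y, y.2 i ^ 2 ∂(κ z) with hkA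
  set m : ℝ := ∫ y, y.2 i ^ 2 ∂ν with hm
  set C₁ := 2 / θ * C with hC₁
  have hdec : ∀ z, |kA z - m| ≤ C₁ * Real.exp (θ * P.hamiltonian M z) * Real.exp (-c * t) :=
    fun z => harris_sq_momentum hω hl hβ hγ hθ hH i z t
  have hϑT : ϑ < 1 / T := by linarith
  have hexp : Integrable (fun z => Real.exp ((θ + ϑ) * P.hamiltonian M z)) μ₀ :=
    pinnedChain_integrable_exp_mul_hamiltonian_gibbsMeasure hω hl hβ γ M hT hθϑ
  have hexpϑ : Integrable (fun z => Real.exp (ϑ * P.hamiltonian M z)) μ₀ :=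
    pinnedChain_integrable_exp_mul_hamiltonian_gibbsMeasure hω hl hβ γ M hT hϑT
  have hgi : Integrable g μ₀ := integrable_of_abs_le_exp hexpϑ hg hgb
  have hkAm : StronglyMeasurable kA :=
    (by fun_prop : Continuous fun y : PhaseSpace M => y.2 i ^ 2).stronglyMeasurable.integral_kernel (κ := κ)
  have hRb : ∀ z, |g z * (kA z - m)| ≤
      C₁ * Cg * Real.exp (-c * t) * Real.exp ((θ + ϑ) * P.hamiltonian M z) := by
    intro z
    rw [abs_mul]
    calc |g z| * |kA z - m|
        ≤ (Cg * Real.exp (ϑ * P.hamiltonian M z)) *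
            (C₁ * Real.exp (θ * P.hamiltonian M z) * Real.exp (-c * t)) :=
          mul_le_mul (hgb z) (hdec z) (abs_nonneg _) ((abs_nonneg _).trans (hgb z))
      _ = C₁ * Cg * Real.exp (-c * t) *
            (Real.exp (θ * P.hamiltonian M z) * Real.exp (ϑ * P.hamiltonian M z)) := by ring
      _ = _ := by rw [← Real.exp_add]; ring_nf
  have hRi : Integrable (fun z => g z * (kA z - m)) μ₀ :=
    (hexp.const_mul (C₁ * Cg * Real.exp (-c * t))).mono'
      (hg.aestronglyMeasurable.mul (hkAm.aestronglyMeasurable.sub aestronglyMeasurable_const))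
      (Eventually.of_forall fun z => by rw [Real.norm_eq_abs]; exact hRb z)
  have hsplit : (fun z => g z * kA z) = fun z => g z * (kA z - m) + m * g z := by
    funext z; ring
  refine ⟨?_, ?_⟩
  · show Integrable (fun z => g z * kA z) μ₀
    rw [hsplit]
    exact hRi.add (hgi.const_mul m)
  · show |(∫ z, g z * kA z ∂μ₀) - (∫ z, g z ∂μ₀) * m| ≤
      C₁ * Cg * (∫ z, Real.exp ((θ + ϑ) * P.hamiltonian M z) ∂μ₀) * Real.exp (-c * t)
    have hI : (∫ z, g z * kA z ∂μ₀) - (∫ z, g z ∂μ₀) * m = ∫ z, g z * (kA z - m) ∂μ₀ := by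
      rw [hsplit, integral_add hRi (hgi.const_mul m), integral_const_mul]
      ring
    rw [hI]
    have h := norm_integral_le_of_norm_le (hexp.const_mul (C₁ * Cg * Real.exp (-c * t)))
      (Eventually.of_forall fun z => by rw [Real.norm_eq_abs]; exact hRb z)
    rw [integral_const_mul, Real.norm_eq_abs] at h
    calc |∫ z, g z * (kA z - m) ∂μ₀|
        ≤ C₁ * Cg * Real.exp (-c * t) * ∫ z, Real.exp ((θ + ϑ) * P.hamiltonian M z) ∂μ₀ := h
      _ = _ := by ring

end Harris

/-- **Registered sub-goal `limitExchange_corrDecay`** of crux stmt-AtomisticToContinuum-11812 (under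
`stub_limitExchange`, line `gibbs-ttcf`): `corr_decay` as a closed statement — for the pinned chain
(`ω₂ > 0`, `lam, β, γ ≥ 0`), a Harris bound at bath temperatures `(a, b)` with limit measure `ν` and constants
`θ > 0`, `C`, `c`, the Gibbs measure at `T > 0`, `ϑ` with `θ + ϑ < 1/T` and a continuous weight
`|g| ≤ C_g e^{ϑH}`: integrability of `g · K_t p_i²` and the bound
`|∫ g K_t p_i² dμ₀ - (∫ g dμ₀) ν(p_i²)| ≤ (2C/θ) C_g (∫ e^{(θ+ϑ)H} dμ₀) e^{-ct}`. [folklore] -/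
theorem limitExchange_corrDecay :
    ∀ ω₂ lam β γ : ℝ, 0 < ω₂ → 0 ≤ lam → 0 ≤ β → 0 ≤ γ → ∀ (M : ℕ) (a b : ℝ) (ν : Measure (PhaseSpace M)) (θ C c : ℝ), 0 < θ → (∀ (z : PhaseSpace M) (t : ℝ≥0) (f : PhaseSpace M → ℝ), Continuous f → (∀ y, |f y| ≤ Real.exp (θ * (pinnedChain ω₂ lam β γ).hamiltonian M y)) → |(∫ y, f y ∂((pinnedChain ω₂ lam β γ).transitionKernel M a b t z)) - ∫ y, f y ∂ν| ≤ C * Real.exp (θ * (pinnedChain ω₂ lam β γ).hamiltonian M z) * Real.exp (-c * t)) → ∀ (T ϑ Cg : ℝ), 0 < T → θ + ϑ < 1 / T → ∀ g : PhaseSpace M → ℝ, Continuous g → (∀ z, |g z| ≤ Cg * Real.exp (ϑ * (pinnedChain ω₂ lam β γ).hamiltonian M z)) → ∀ (i : Fin M) (t : ℝ≥0), Integrable (fun z => g z * ∫ y, y.2 i ^ 2 ∂((pinnedChain ω₂ lam β γ).transitionKernel M a b t z)) ((pinnedChain ω₂ lam β γ).gibbsMeasure M T) ∧ |(∫ z,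 g z * ∫ y, y.2 i ^ 2 ∂((pinnedChain ω₂ lam β γ).transitionKernel M a b t z) ∂((pinnedChain ω₂ lam β γ).gibbsMeasure M T)) - (∫ z, g z ∂((pinnedChain ω₂ lam β γ).gibbsMeasure M T)) * ∫ y, y.2 i ^ 2 ∂ν| ≤ 2 / θ * C * Cg * (∫ z, Real.exp ((θ + ϑ) * (pinnedChain ω₂ lam β γ).hamiltonian M z) ∂((pinnedChain ω₂ lam β γ).gibbsMeasure M T)) * Real.exp (-c * t) :=
  fun _ _ _ _ hω hl hβ hγ _ _ _ _ _ _ _ hθ hH _ _ _ hT hθϑ _ hg hgb i t =>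
    corr_decay hω hl hβ hγ hθ hH hT hθϑ hg hgb i t

/-- `|p_i² - p_j²| ≤ (4/ϑ) e^{ϑH}` for a chain with nonnegative potentials and `ϑ > 0`. [folklore] -/
theorem abs_sq_sub_sq_le_exp {P : OscillatorChain} (hP : P.IsConfining) {ϑ : ℝ} (hϑ : 0 < ϑ) (M : ℕ)
    (z : PhaseSpace M) (i j : Fin M) :
    |z.2 i ^ 2 - z.2 j ^ 2| ≤ 4 / ϑ * Real.exp (ϑ * P.hamiltonian M z) :=
  calc |z.2 i ^ 2 - z.2 j ^ 2| ≤ |z.2 i ^ 2| + |z.2 j ^ 2| := abs_sub _ _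
    _ ≤ 2 / ϑ * Real.exp (ϑ * P.hamiltonian M z) + 2 / ϑ * Real.exp (ϑ * P.hamiltonian M z) :=
        add_le_add (abs_sq_momentum_le_exp hP hϑ M z i) (abs_sq_momentum_le_exp hP hϑ M z j)
    _ = 4 / ϑ * Real.exp (ϑ * P.hamiltonian M z) := by ring

/-! ### Pointwise continuity in `δ` of Gibbs-weighted kernel moments -/

section Family

variable {ω₂ lam β γ : ℝ} (hω : 0 < ω₂) (hl : 0 ≤ lam) (hβ : 0 ≤ β) (hγ : 0 ≤ γ) {N : ℕ} {T : ℝ}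
  (hT : 0 < T) {δ₀ θ C c : ℝ} (hδ₀ : 0 < δ₀) (hθ : 0 < θ) {ν : ℝ → Measure (PhaseSpace (N + 1))}
  (hH : ∀ δ : ℝ, |δ| ≤ δ₀ → ∀ (z : PhaseSpace (N + 1)) (t : ℝ≥0) (f : PhaseSpace (N + 1) → ℝ),
    Continuous f → (∀ y, |f y| ≤ Real.exp (θ * (pinnedChain ω₂ lam β γ).hamiltonian (N + 1) y)) →
    |(∫ y, f y ∂((pinnedChain ω₂ lam β γ).transitionKernel (N + 1) (T + δ / 2) (T - δ / 2) t z)) -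
        ∫ y, f y ∂(ν δ)| ≤
      C * Real.exp (θ * (pinnedChain ω₂ lam β γ).hamiltonian (N + 1) z) * Real.exp (-c * t))
  (hK : ∀ (s : ℝ≥0) (z : PhaseSpace (N + 1)), Tendsto (fun δ : ℝ => ∫ y, (y.2 (Fin.last N)) ^ 2
      ∂((pinnedChain ω₂ lam β γ).transitionKernel (N + 1) (T + δ / 2) (T - δ / 2) s z)) (𝓝 0)
    (𝓝 (∫ y, (y.2 (Fin.last N)) ^ 2 ∂((pinnedChain ω₂ lam β γ).transitionKernel (N + 1) T T s z))))
include hω hl hβ hγ hT hδ₀ hθ hH hK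

/-- **`δ → 0` inside the Gibbs integral.** Under a Harris bound uniform in `|δ| ≤ δ₀` for the kernels
`K^δ_s = transitionKernel (N+1) (T+δ/2) (T-δ/2) s` and pointwise continuity of `δ ↦ K^δ_s p_N²(z)` at `0`,
for every continuous weight `|g| ≤ C_g e^{ϑH}` with `θ + ϑ < 1/T`:
`∫ g · K^δ_s p_N² dμ₀ → ∫ g · K_s p_N² dμ₀` (`δ → 0`) — dominated convergence, the dominating function
`|g| (B + (2C/θ) e^{-cs} e^{θH})` coming from `|ν_δ(p_N²)| ≤ B` (`abs_steady_sq_momentum_le`) and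
`harris_sq_momentum`. [folklore] -/
theorem tendsto_corr_delta {ϑ Cg : ℝ} (hθϑ : θ + ϑ < 1 / T) {g : PhaseSpace (N + 1) → ℝ} (hg : Continuous g)
    (hgb : ∀ z, |g z| ≤ Cg * Real.exp (ϑ * (pinnedChain ω₂ lam β γ).hamiltonian (N + 1) z)) (s : ℝ≥0) :
    Tendsto (fun δ : ℝ => ∫ z, g z * ∫ y, (y.2 (Fin.last N)) ^ 2
        ∂((pinnedChain ω₂ lam β γ).transitionKernel (N + 1) (T + δ / 2) (T - δ / 2) s z)
        ∂((pinnedChain ω₂ lam β γ).gibbsMeasure (N + 1) T)) (𝓝 0)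
      (𝓝 (∫ z, g z * ∫ y, (y.2 (Fin.last N)) ^ 2 ∂((pinnedChain ω₂ lam β γ).transitionKernel (N + 1) T T s z)
        ∂((pinnedChain ω₂ lam β γ).gibbsMeasure (N + 1) T))) := by
  set P := pinnedChain ω₂ lam β γ with hPdef
  set μ₀ := P.gibbsMeasure (N + 1) T with hμ₀
  set C₁ := 2 / θ * C with hC₁
  set B := C₁ * Real.exp (θ * P.hamiltonian (N + 1) 0) with hB
  set C₂ := C₁ * Real.exp (-c * s) with hC₂
  have hϑT : ϑ < 1 / T := by linarith
  have hHc : Continuous (P.hamiltonian (N + 1)) := pinnedChain_continuous_hamiltonian ω₂ lam β γ (N + 1)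
  have hexp : Integrable (fun z => Real.exp ((θ + ϑ) * P.hamiltonian (N + 1) z)) μ₀ :=
    pinnedChain_integrable_exp_mul_hamiltonian_gibbsMeasure hω hl hβ γ (N + 1) hT hθϑ
  have hexpϑ : Integrable (fun z => Real.exp (ϑ * P.hamiltonian (N + 1) z)) μ₀ :=
    pinnedChain_integrable_exp_mul_hamiltonian_gibbsMeasure hω hl hβ γ (N + 1) hT hϑT
  -- the dominating function
  set bound : PhaseSpace (N + 1) → ℝ := fun z =>
    |g z| * (B + C₂ * Real.exp (θ * P.hamiltonian (N + 1) z)) with hbound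
  have hBC : 0 ≤ B ∧ 0 ≤ C₂ := by
    have h := abs_steady_sq_momentum_le hω hl hβ hγ hθ (hH 0 (by rw [abs_zero]; exact hδ₀.le)) (Fin.last N)
    have hB0 : 0 ≤ B := (abs_nonneg _).trans h
    have hC₁0 : 0 ≤ C₁ := nonneg_of_mul_nonneg_left hB0 (Real.exp_pos _)
    exact ⟨hB0, mul_nonneg hC₁0 (Real.exp_pos _).le⟩
  have hbd0 : ∀ z, 0 ≤ B + C₂ * Real.exp (θ * P.hamiltonian (N + 1) z) := fun z =>
    add_nonneg hBC.1 (mul_nonneg hBC.2 (Real.exp_pos _).le)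
  have hbint : Integrable bound μ₀ := by
    refine ((hexpϑ.const_mul (Cg * B)).add (hexp.const_mul (Cg * C₂))).mono'
      ((continuous_abs.comp hg).mul (continuous_const.add (continuous_const.mul
        (Real.continuous_exp.comp (continuous_const.mul hHc))))).aestronglyMeasurable
      (Eventually.of_forall fun z => ?_)
    rw [Real.norm_of_nonneg (mul_nonneg (abs_nonneg _) (hbd0 z))]
    calc |g z| * (B + C₂ * Real.exp (θ * P.hamiltonian (N + 1) z))
        ≤ (Cg * Real.exp (ϑ * P.hamiltonian (N + 1) z)) * (B + C₂ * Real.exp (θ * P.hamiltonian (N + 1) z)) :=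
          mul_le_mul_of_nonneg_right (hgb z) (hbd0 z)
      _ = Cg * B * Real.exp (ϑ * P.hamiltonian (N + 1) z) +
          Cg * C₂ * (Real.exp (θ * P.hamiltonian (N + 1) z) * Real.exp (ϑ * P.hamiltonian (N + 1) z)) := by
          ring
      _ = Cg * B * Real.exp (ϑ * P.hamiltonian (N + 1) z) +
          Cg * C₂ * Real.exp ((θ + ϑ) * P.hamiltonian (N + 1) z) := by rw [← Real.exp_add]; ring_nf
  have hev : ∀ᶠ δ in 𝓝 (0 : ℝ), |δ| ≤ δ₀ := by
    filter_upwards [eventually_abs_sub_lt 0 hδ₀] with δ hδ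
    rw [sub_zero] at hδ
    exact hδ.le
  refine tendsto_integral_filter_of_dominated_convergence bound ?_ ?_ hbint ?_
  · refine Eventually.of_forall fun δ => hg.aestronglyMeasurable.mul ?_
    exact ((by fun_prop : Continuous fun y : PhaseSpace (N + 1) => y.2 (Fin.last N) ^ 2).stronglyMeasurable
      |>.integral_kernel (κ := P.transitionKernel (N + 1) (T + δ / 2) (T - δ / 2) s)).aestronglyMeasurable
  · filter_upwards [hev] with δ hδ
    refine Eventually.of_forall fun z => ?_
    have hm := abs_steady_sq_momentum_le hω hl hβ hγ hθ (hH δ hδ) (Fin.last N)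
    have hd := harris_sq_momentum hω hl hβ hγ hθ (hH δ hδ) (Fin.last N) z s
    rw [norm_mul, Real.norm_eq_abs, Real.norm_eq_abs]
    refine mul_le_mul_of_nonneg_left ?_ (abs_nonneg _)
    have htri : ∀ x y : ℝ, |x| ≤ |y| + |x - y| := fun x y => by
      linarith [abs_sub_abs_le_abs_sub x y]
    calc |∫ y, y.2 (Fin.last N) ^ 2 ∂(P.transitionKernel (N + 1) (T + δ / 2) (T - δ / 2) s z)|
        ≤ |∫ y, y.2 (Fin.last N) ^ 2 ∂(ν δ)| +
          |(∫ y, y.2 (Fin.last N) ^ 2 ∂(P.transitionKernel (N + 1) (T + δ / 2) (T - δ / 2) s z)) -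
            ∫ y, y.2 (Fin.last N) ^ 2 ∂(ν δ)| := htri _ _
      _ ≤ B + C₂ * Real.exp (θ * P.hamiltonian (N + 1) z) := by
          refine add_le_add hm ?_
          calc _ ≤ C₁ * Real.exp (θ * P.hamiltonian (N + 1) z) * Real.exp (-c * s) := hd
            _ = C₂ * Real.exp (θ * P.hamiltonian (N + 1) z) := by ring
  · exact Eventually.of_forall fun z => (hK s z).const_mul (g z)

end Family

end Summit.AtomisticToContinuum.FouriersLaw.Theorems.BoundaryKubo.GibbsTtcf

end
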